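import Summits.Ventures.CertifiedManyBodySolver.Rows.DopedTLCorrBundleWN
import HarnessLib

/-!
# Bundle-WN rows WITH A DOUBLE-OCCUPANCY CEILING SLOT («DOCC-BOX» edition): the claim-node SHAPE of a pinned-pair read whose reader carried
# one extra declared row `ω-docc ≤ dhi`, and its elimination into the plain thick box window row once that ground-state-class premise is
# discharged by name (cell `pub/hubbard-obs`, D-0154 (1)(C) COVERAGE Hg-1201; captain hubbard-cov-hg1201-plan-1 g3 RULING 2026-08-28T12:53:16Z
# «DOCC-BOX EDITION OF RECORD = (ii′) GS-VALID docc CEILING BY NAME, READER LITERAL hi = 1/4»; node: «ONE extra GS-class premise slot per U-cell»)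

HONEST FRAMING: NOTHING IS ASSERTED HERE: a `def … : Prop` and solver-free edges; no `sorry`, no named fact, zero compute. Companion of
`Rows/DopedTLCorrBundleWN.lean` (same seat, `hubbard-cov-hg1201-box-1`, `prover-hubbard-cov-hg1201-box-1-g0-0`).

WHY. The U-direction pinned-pair cross term is `L = ΔU · |κ_cap(U_B) − κ_cap(U_A)| · B_docc` (hubbard-cov-hg1201-sdp-2, kit j307651: the ONLY `U`-dependent datum outside the
pinned eom rows is the coefficient `U` of the double occupancy `⟨n↑n↓⟩` in the energy-cap row), with `B_docc` the reader's a-priori range of that variable (`[0, n/2]` by default).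
Declaring a TIGHTER range `⟨n↑n↓⟩ ≤ dhi` (e.g. `1/4`) — TRUE on the torus-limit ground-state class inside the energy window (`U·docc = e − kinetic ≤ cap − ε_free`,
`Literature.…InfVolFermionState.IsTranslationInvariant.docc_le_secant_of_meanEnergy_le`; hubbard-cov-hg1201-box-2's `Certificates/HubbardSquare_Hg1201_gsDoccCeilings.lean`) —
shrinks `L` and may close a cell at level 0; the price is ONE more premise on the state class, which the reading must then DISCHARGE. This file types

* §A the SHAPE `SquareTTPrimeBundleOrbitLowerRowWND U₁ U₂ s₁ s₂ flo cap dhi F sl₁ sl₂ n₀ S Λ X` = `SquareTTPrimeBundleOrbitLowerRowWN` with ONE extra hypothesis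
  `ω.meanEnergy (hubbardTTPrimeFermionInteraction 0 0 1) 1 ≤ dhi` (the state's double-occupancy density — the `U`-coefficient of its `t–t′–U` energy,
  `InfVolFermionState.meanEnergy_hubbardTTPrime_affine`; for a translation-invariant state the site-`0` double occupancy the reader's variable denotes);
* §B edges: the WN shape implies the WND shape (any `dhi`); `dhi`-monotonicity;
* §C **WND SHAPE + the docc ceiling DISCHARGED on the thick cell ⇒ the THICK box window row** `SquareTTPrimeCorrOrbitLowerBoxRowW …` (exactly the conclusion of
  `SquareTTPrimeBundleOrbitLowerRowWN.orbitLowerBoxRowW_thick`) — so every existing Hg-1201 closer consumes a DOCC-BOX read unchanged.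

References: S. Boyd, L. Vandenberghe, *Convex Optimization* (2004) §5.9 [BoydVandenberghe2004]; J. Wang et al., PRX 14 (2024) 031006, §III [WangEtAl2024];
D. Ruelle, *Statistical Mechanics* (1969) §3.4 [Ruelle1969].
-/

noncomputable section

namespace Summit.Ventures.CertifiedManyBodySolver

open Literature.MathematicalPhysics.QuantumLattice
open Matrix HubbardWave0 Literature.Probability.LatticeModels ThermodynamicLimit Filter Topology
open Summit.Ventures.CertifiedManyBodySolver.Downfold (wnBundleValue)
open scoped BigOperators ComplexOrder

/-! ## §A  The bundle-WN row shape with a double-occupancy ceiling slot -/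

/-- §A **BUNDLE-WN ROW SHAPE WITH A DOCC CEILING SLOT** `SquareTTPrimeBundleOrbitLowerRowWND U₁ U₂ s₁ s₂ flo cap dhi F sl₁ sl₂ n₀ S Λ X`: as
`SquareTTPrimeBundleOrbitLowerRowWN` (parameter rectangle `U ∈ [U₁, U₂]`, `t′ ∈ [s₁, s₂]`, window functions `flo cap`, every density `x ∈ [0, 2)`, every torus limit of
unit sector ground states at `(s, U, x)`), with ONE extra premise on the state: `ω.meanEnergy (hubbardTTPrimeFermionInteraction 0 0 1) 1 ≤ dhi` (its double-occupancy
density is below the reader's declared literal `dhi`); conclusion `wnBundleValue F sl₁ sl₂ n₀ x ≤ |S|⁻¹ Σ_{γ ∈ S} Re ω_{γΛ}(Γ(d4Emb γ 0) X)`. [cite: BoydVandenberghe2004, §5.9] -/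
def SquareTTPrimeBundleOrbitLowerRowWND (U₁ U₂ s₁ s₂ : ℝ) (flo cap : ℝ → ℝ → ℝ) (dhi : ℚ) (F sl₁ sl₂ n₀ : ℚ)
    (S : Finset (DihedralGroup 4)) (Λ : Finset (Site 2)) (X : FermionOp Λ) : Prop :=
  ∀ U ∈ Set.Icc U₁ U₂, ∀ s ∈ Set.Icc s₁ s₂, ∀ x : ℝ, 0 ≤ x → x < 2 →
    ∀ (ω : InfVolFermionState 2) (Ls : ℕ → ℕ) (ψ : ∀ L, Fock (Orb (FermionTorus 2 L))),
      Tendsto Ls atTop atTop →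
      (∀ j, IsGroundStateInSector (hubbardTorusTT' (Ls j) 1 s U) (rectN x (Ls j)) 0 (ψ (Ls j))) →
      (∀ j, star (ψ (Ls j)) ⬝ᵥ ψ (Ls j) = 1) → ω.IsTorusLimitOf ψ Ls →
      flo U s ≤ energyDensityTT' 1 s U x → energyDensityTT' 1 s U x ≤ cap U s →
      ω.meanEnergy (hubbardTTPrimeFermionInteraction 0 0 1) 1 ≤ ((dhi : ℚ) : ℝ) →
      wnBundleValue F sl₁ sl₂ n₀ x ≤
        (S.card : ℝ)⁻¹ * ∑ g ∈ S, (ω.expect (d4ShiftSet g 0 Λ) (fermionEmbed (PolySite.d4Emb g 0 Λ) X)).re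

/-! ## §B  Solver-free edges -/

section Edges

variable {U₁ U₂ s₁ s₂ : ℝ} {flo cap : ℝ → ℝ → ℝ} {dhi dhi' F sl₁ sl₂ n₀ : ℚ} {S : Finset (DihedralGroup 4)}
  {Λ : Finset (Site 2)} {X : FermionOp Λ}

/-- A plain bundle-WN row is a WND row for EVERY docc literal (the extra premise is simply not used). [folklore] -/
theorem SquareTTPrimeBundleOrbitLowerRowWN.toWND (h : SquareTTPrimeBundleOrbitLowerRowWN U₁ U₂ s₁ s₂ flo cap F sl₁ sl₂ n₀ S Λ X) (dhi : ℚ) :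
    SquareTTPrimeBundleOrbitLowerRowWND U₁ U₂ s₁ s₂ flo cap dhi F sl₁ sl₂ n₀ S Λ X :=
  fun U hU s hs x hx0 hx2 ω Ls ψ hLs hψ hψ1 hω hl hu _ => h U hU s hs x hx0 hx2 ω Ls ψ hLs hψ hψ1 hω hl hu

/-- `dhi`-monotonicity: a WND row survives any SMALLER declared docc literal (fewer states qualify). [folklore] -/
theorem SquareTTPrimeBundleOrbitLowerRowWND.mono_dhi (h : SquareTTPrimeBundleOrbitLowerRowWND U₁ U₂ s₁ s₂ flo cap dhi F sl₁ sl₂ n₀ S Λ X)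
    (hd : dhi' ≤ dhi) : SquareTTPrimeBundleOrbitLowerRowWND U₁ U₂ s₁ s₂ flo cap dhi' F sl₁ sl₂ n₀ S Λ X := by
  intro U hU s hs x hx0 hx2 ω Ls ψ hLs hψ hψ1 hω hl hu hdocc
  have hd' : ((dhi' : ℚ) : ℝ) ≤ ((dhi : ℚ) : ℝ) := by exact_mod_cast hd
  exact h U hU s hs x hx0 hx2 ω Ls ψ hLs hψ hψ1 hω hl hu (hdocc.trans hd')

end Edges

/-! ## §C  WND SHAPE + docc ceiling discharged on the thick cell ⇒ the THICK box window row -/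

section Thick

variable {U₁ U₂ s₁ s₂ : ℝ} {flo cap : ℝ → ℝ → ℝ} {dhi F sl₁ sl₂ n₀ : ℚ} {S : Finset (DihedralGroup 4)}
  {Λ : Finset (Site 2)} {X : FermionOp Λ}

/-- **WND SHAPE ⇒ THICK BOX WINDOW ROW, the docc ceiling DISCHARGED.** `0 ≤ n₁`, `n₂ < 2`; a rational slot `r` below the four end values `F + sl_j·(n_e − n₀)`; and the
GROUND-STATE-CLASS premise discharged on the thick cell: for every `(U, s)` of the rectangle, every density `x ∈ [n₁, n₂]` and every torus-limit sector ground state `ω` there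
obeying the cap row, `ω.meanEnergy (hubbardTTPrimeFermionInteraction 0 0 1) 1 ≤ dhi` (`hdocc` — e.g. hubbard-cov-hg1201-box-2's GS docc ceilings from the energy window).
Then `SquareTTPrimeCorrOrbitLowerBoxRowW ![U₁, s₁, n₁] ![U₂, s₂, n₂] (fun θ ↦ flo (θ 0) (θ 1)) (fun θ ↦ cap (θ 0) (θ 1)) r S Λ X` — the SAME conclusion as the plain shape's
`…WN.orbitLowerBoxRowW_thick`, so every downstream closer is unchanged. [cite: BoydVandenberghe2004, §5.9] [cite: WangEtAl2024, §III] [cite: Ruelle1969, §3.4] -/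
theorem SquareTTPrimeBundleOrbitLowerRowWND.orbitLowerBoxRowW_thick
    (h : SquareTTPrimeBundleOrbitLowerRowWND U₁ U₂ s₁ s₂ flo cap dhi F sl₁ sl₂ n₀ S Λ X) {n₁ n₂ : ℝ} (hn₁ : 0 ≤ n₁) (hn₂ : n₂ < 2)
    (hdocc : ∀ U ∈ Set.Icc U₁ U₂, ∀ s ∈ Set.Icc s₁ s₂, ∀ x ∈ Set.Icc n₁ n₂,
      ∀ (ω : InfVolFermionState 2) (Ls : ℕ → ℕ) (ψ : ∀ L, Fock (Orb (FermionTorus 2 L))),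
      Tendsto Ls atTop atTop →
      (∀ j, IsGroundStateInSector (hubbardTorusTT' (Ls j) 1 s U) (rectN x (Ls j)) 0 (ψ (Ls j))) →
      (∀ j, star (ψ (Ls j)) ⬝ᵥ ψ (Ls j) = 1) → ω.IsTorusLimitOf ψ Ls →
      energyDensityTT' 1 s U x ≤ cap U s →
      ω.meanEnergy (hubbardTTPrimeFermionInteraction 0 0 1) 1 ≤ ((dhi : ℚ) : ℝ))
    {r : ℚ}
    (h₁₁ : ((r : ℚ) : ℝ) ≤ ((F : ℚ) : ℝ) + ((sl₁ : ℚ) : ℝ) * (n₁ - ((n₀ : ℚ) : ℝ)))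
    (h₁₂ : ((r : ℚ) : ℝ) ≤ ((F : ℚ) : ℝ) + ((sl₁ : ℚ) : ℝ) * (n₂ - ((n₀ : ℚ) : ℝ)))
    (h₂₁ : ((r : ℚ) : ℝ) ≤ ((F : ℚ) : ℝ) + ((sl₂ : ℚ) : ℝ) * (n₁ - ((n₀ : ℚ) : ℝ)))
    (h₂₂ : ((r : ℚ) : ℝ) ≤ ((F : ℚ) : ℝ) + ((sl₂ : ℚ) : ℝ) * (n₂ - ((n₀ : ℚ) : ℝ))) :
    SquareTTPrimeCorrOrbitLowerBoxRowW ![U₁, s₁, n₁] ![U₂, s₂, n₂] (fun θ => flo (θ 0) (θ 1)) (fun θ => cap (θ 0) (θ 1))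
      r S Λ X := by
  intro θ hθ ω Ls ψ hLs hψ hψ1 hω hl hu
  obtain ⟨⟨h0, h0'⟩, ⟨h1, h1'⟩, ⟨h2, h2'⟩⟩ := mem_thickCell_vec3 hθ
  have hd := hdocc (θ 0) ⟨h0, h0'⟩ (θ 1) ⟨h1, h1'⟩ (θ 2) ⟨h2, h2'⟩ ω Ls ψ hLs hψ hψ1 hω hu
  have hrow := h (θ 0) ⟨h0, h0'⟩ (θ 1) ⟨h1, h1'⟩ (θ 2) (hn₁.trans h2) (lt_of_le_of_lt h2' hn₂) ω Ls ψ hLs hψ hψ1 hω hl hu hd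
  exact (le_wnBundleValue_of_ends h2 h2' h₁₁ h₁₂ h₂₁ h₂₂).trans hrow

/-- **The same with RATIONAL density ends** (prices decidable by `norm_num` at every instance). [cite: BoydVandenberghe2004, §5.9] -/
theorem SquareTTPrimeBundleOrbitLowerRowWND.orbitLowerBoxRowW_thick_rat
    (h : SquareTTPrimeBundleOrbitLowerRowWND U₁ U₂ s₁ s₂ flo cap dhi F sl₁ sl₂ n₀ S Λ X) {n₁ n₂ : ℚ} (hn₁ : 0 ≤ n₁) (hn₂ : n₂ < 2)
    (hdocc : ∀ U ∈ Set.Icc U₁ U₂, ∀ s ∈ Set.Icc s₁ s₂, ∀ x ∈ Set.Icc ((n₁ : ℚ) : ℝ) ((n₂ : ℚ) : ℝ),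
      ∀ (ω : InfVolFermionState 2) (Ls : ℕ → ℕ) (ψ : ∀ L, Fock (Orb (FermionTorus 2 L))),
      Tendsto Ls atTop atTop →
      (∀ j, IsGroundStateInSector (hubbardTorusTT' (Ls j) 1 s U) (rectN x (Ls j)) 0 (ψ (Ls j))) →
      (∀ j, star (ψ (Ls j)) ⬝ᵥ ψ (Ls j) = 1) → ω.IsTorusLimitOf ψ Ls →
      energyDensityTT' 1 s U x ≤ cap U s →
      ω.meanEnergy (hubbardTTPrimeFermionInteraction 0 0 1) 1 ≤ ((dhi : ℚ) : ℝ))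
    {r : ℚ} (h₁₁ : r ≤ F + sl₁ * (n₁ - n₀)) (h₁₂ : r ≤ F + sl₁ * (n₂ - n₀)) (h₂₁ : r ≤ F + sl₂ * (n₁ - n₀))
    (h₂₂ : r ≤ F + sl₂ * (n₂ - n₀)) :
    SquareTTPrimeCorrOrbitLowerBoxRowW ![U₁, s₁, ((n₁ : ℚ) : ℝ)] ![U₂, s₂, ((n₂ : ℚ) : ℝ)] (fun θ => flo (θ 0) (θ 1))
      (fun θ => cap (θ 0) (θ 1)) r S Λ X :=
  h.orbitLowerBoxRowW_thick (by exact_mod_cast hn₁) (by exact_mod_cast hn₂) hdocc (by exact_mod_cast h₁₁) (by exact_mod_cast h₁₂)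
    (by exact_mod_cast h₂₁) (by exact_mod_cast h₂₂)

end Thick

end Summit.Ventures.CertifiedManyBodySolver

end
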